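import Mathlib
import Summits.Ventures.PercRepro2.V1ParallelClosure

/-! # The down-set form (UH) of (U) is closed under series composition, given the level Harris inequalities
(seat mine-b, cell pub-perc-repro2; conjectures/MINE-B.md §20)

`DownDom r b` (V1ParallelClosure.lean) is the Hall form (UH) of the level-summed row (U): every LOWER
set of the configuration poset has non-negative `ν`-mass, `ν = [r = 1] − b·[r = 0]`.  For the series
composition (labels are MINIMA on the product) the closure is FALSE for arbitrary labelled posets
(MINE-B.md §19.3(d)); it holds as soon as both parts also satisfy the **capped Harris inequalities**

  `CapHarris r b : ∀ lower D, ∀ β, 0 ≤ Σ_{x ∈ D} (min (r x) β − min (b x) β)`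

(on a pattern cube: Harris–Kleitman twice on `{r ≥ j}` (lower) and `{b ≥ j}` (upper) with
`#{r ≥ j} = #{b ≥ j}` by the colour swap, summed over `j ≤ β`).  The proof is a fibrewise
accounting with a POINTWISE certificate: with `φ(ρ, β; a, c) := λ(ρ,β)·ν(a,c) + μ(ρ)·(min a κ − min c κ)`
(`κ = 1` at red level `ρ = 1`, `κ = β` at `ρ = 0`; `λ ∈ {2, 1, 0}`, `μ ∈ {1, 0}`), one has

  `φ(r_y, b_y; r_x, b_x) + φ(r_x, b_x; r_y, b_y) ≤ 2·ν_{X∧Y}(x, y)`   (`pointwise`),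

and summing over a lower set `D` of the product the two halves are non-negative combinations of
(UH) and the capped Harris inequality on the fibres `D^y`, `D_x` (`downDom_ser`).  The certificate
was found by an exact Farkas LP over per-label fibre multipliers and verified exhaustively for all
labels `≤ 12`. -/

namespace Summit.Ventures.PercRepro2.UHClosure

open Finset

variable {X Y : Type*}

/-- **Capped Harris inequality**: every lower set `D` and every cap `β` have
`Σ_{x ∈ D} (min (r x) β − min (b x) β) ≥ 0` — equivalently `#(D ∩ {r ≥ j}) ≥ #(D ∩ {b ≥ j})` for all `j ≥ 1`. -/
def CapHarris [Preorder X] (r b : X → ℕ) : Prop :=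
  ∀ D : Finset X, IsLowerSet (↑D : Set X) → ∀ β : ℕ,
    0 ≤ ∑ x ∈ D, (((min (r x) β : ℕ) : ℤ) - ((min (b x) β : ℕ) : ℤ))

/-- the multiplier of (UH) at a fibre with labels `(ρ, β)` (twice the rational one: `2, 1, 1, 0`) -/
def lam2 (ρ β : ℕ) : ℤ :=
  if 2 ≤ ρ then (if 1 ≤ β then 2 else 1) else if ρ = 1 then (if 1 ≤ β then 1 else 0) else 0

/-- the cap of the Harris inequality used at a fibre with labels `(ρ, β)`: `1` at `ρ = 1`, `β` otherwise -/
def kap (ρ β : ℕ) : ℕ := if ρ = 1 then 1 else β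

/-- the multiplier of the capped Harris inequality: `1` at red level `≤ 1`, `0` above -/
def mu (ρ : ℕ) : ℤ := if ρ ≤ 1 then 1 else 0

/-- the weight `ν` as a function of the two labels: `[a = 1] − c·[a = 0]` -/
def nuv (a c : ℕ) : ℤ := (if a = 1 then 1 else 0) - (if a = 0 then (c : ℤ) else 0)

/-- the certificate weight charged by a fibre with labels `(ρ, β)` to a point with labels `(a, c)` -/
def phi2 (ρ β a c : ℕ) : ℤ :=
  lam2 ρ β * nuv a c + mu ρ * (((min a (kap ρ β) : ℕ) : ℤ) - ((min c (kap ρ β) : ℕ) : ℤ))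

/-- the weight `ν` of the series composition at a point with labels `(a, c)`, `(ρ, β)` -/
def wser (a c ρ β : ℕ) : ℤ :=
  (if min a ρ = 1 then 1 else 0) - (if min a ρ = 0 then ((min c β : ℕ) : ℤ) else 0)

/-- **The pointwise certificate**: the two fibre charges are dominated by twice the series weight. -/
theorem pointwise (a c ρ β : ℕ) : phi2 ρ β a c + phi2 a c ρ β ≤ 2 * wser a c ρ β := by
  unfold phi2 lam2 kap mu nuv wser
  rcases Nat.lt_or_ge a 2 with ha | ha
  · rcases Nat.lt_or_ge ρ 2 with hρ | hρ
    · interval_cases a <;> interval_cases ρ <;> simp <;> omega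
    · interval_cases a <;> simp [hρ, show ¬ ρ = 1 by omega, show ¬ ρ ≤ 1 by omega] <;> split_ifs <;> omega
  · rcases Nat.lt_or_ge ρ 2 with hρ | hρ
    · interval_cases ρ <;> simp [ha, show ¬ a = 1 by omega, show ¬ a ≤ 1 by omega] <;> split_ifs <;> omega
    · simp [ha, hρ, show ¬ a = 1 by omega, show ¬ ρ = 1 by omega, show ¬ a ≤ 1 by omega, show ¬ ρ ≤ 1 by omega]
      split_ifs <;> omega

/-- the multiplier `lam2` is non-negative -/
theorem lam2_nonneg (ρ β : ℕ) : 0 ≤ lam2 ρ β := by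
  unfold lam2; split_ifs <;> norm_num

/-- the multiplier `mu` is non-negative -/
theorem mu_nonneg (ρ : ℕ) : 0 ≤ mu ρ := by
  unfold mu; split_ifs <;> norm_num

/-- `ν` of the series labels is `wser` of the four labels -/
theorem nu_ser_eq (r b : X → ℕ) (r' b' : Y → ℕ) (x : X) (y : Y) :
    nu (fun p : X × Y => min (r p.1) (r' p.2)) (fun p : X × Y => min (b p.1) (b' p.2)) (x, y)
      = wser (r x) (b x) (r' y) (b' y) := rfl

/-- `nuv` of the labels of a point is `ν` at that point -/
theorem nuv_eq (r b : X → ℕ) (x : X) : nuv (r x) (b x) = nu r b x := rfl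

section fibres

variable [Preorder X] [Preorder Y] [Fintype X] [Fintype Y] [DecidableEq X] [DecidableEq Y]

omit [Preorder X] [Preorder Y] in
/-- a sum over `D` of a function of both coordinates, as a double sum with the indicator -/
theorem sum_D_eq' (D : Finset (X × Y)) (F : X → Y → ℤ) :
    ∑ p ∈ D, F p.1 p.2 = ∑ x, ∑ y, ind D x y * F x y := by
  rw [← Finset.sum_product' (s := (univ : Finset X)) (t := (univ : Finset Y))
    (f := fun x y => ind D x y * F x y)]
  rw [← Finset.sum_filter_add_sum_filter_not (univ ×ˢ univ) (fun p => p ∈ D)]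
  have h1 : ∑ p ∈ (univ ×ˢ univ).filter (fun p : X × Y => p ∈ D),
      ind D p.1 p.2 * F p.1 p.2 = ∑ p ∈ D, F p.1 p.2 := by
    have : (univ ×ˢ univ).filter (fun p : X × Y => p ∈ D) = D := by ext p; simp
    rw [this]
    exact Finset.sum_congr rfl (fun p hp => by simp [ind, hp])
  have h2 : ∑ p ∈ (univ ×ˢ univ).filter (fun p : X × Y => ¬ p ∈ D),
      ind D p.1 p.2 * F p.1 p.2 = 0 := by
    apply Finset.sum_eq_zero
    intro p hp
    simp only [Finset.mem_filter] at hp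
    simp [ind, hp.2]
  rw [h1, h2, add_zero]

omit [Fintype Y] in
/-- the capped Harris inequality of `X` on the fibre over `y` -/
theorem fibre_fst_cap (r b : X → ℕ) (hX : CapHarris r b) (D : Finset (X × Y))
    (hD : IsLowerSet (↑D : Set (X × Y))) (y : Y) (κ : ℕ) :
    0 ≤ ∑ x, ind D x y * (((min (r x) κ : ℕ) : ℤ) - ((min (b x) κ : ℕ) : ℤ)) := by
  have h := hX (univ.filter (fun x : X => (x, y) ∈ D)) (fibre_fst_isLowerSet D hD y) κ
  rw [Finset.sum_filter] at h
  have : ∑ x, ind D x y * (((min (r x) κ : ℕ) : ℤ) - ((min (b x) κ : ℕ) : ℤ))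
      = ∑ x, (if (x, y) ∈ D then (((min (r x) κ : ℕ) : ℤ) - ((min (b x) κ : ℕ) : ℤ)) else 0) := by
    apply Finset.sum_congr rfl; intro x _; unfold ind; split_ifs <;> simp
  rw [this]; exact h

omit [Fintype X] in
/-- the capped Harris inequality of `Y` on the fibre over `x` -/
theorem fibre_snd_cap (r' b' : Y → ℕ) (hY : CapHarris r' b') (D : Finset (X × Y))
    (hD : IsLowerSet (↑D : Set (X × Y))) (x : X) (κ : ℕ) :
    0 ≤ ∑ y, ind D x y * (((min (r' y) κ : ℕ) : ℤ) - ((min (b' y) κ : ℕ) : ℤ)) := by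
  have h := hY (univ.filter (fun y : Y => (x, y) ∈ D)) (fibre_snd_isLowerSet D hD x) κ
  rw [Finset.sum_filter] at h
  have : ∑ y, ind D x y * (((min (r' y) κ : ℕ) : ℤ) - ((min (b' y) κ : ℕ) : ℤ))
      = ∑ y, (if (x, y) ∈ D then (((min (r' y) κ : ℕ) : ℤ) - ((min (b' y) κ : ℕ) : ℤ)) else 0) := by
    apply Finset.sum_congr rfl; intro y _; unfold ind; split_ifs <;> simp
  rw [this]; exact h

omit [Fintype Y] in
/-- the charge of the fibre over `y` is a non-negative combination of (UH) and capped Harris on `X` -/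
theorem fibre_phi_fst (r b : X → ℕ) (hX : DownDom r b) (hXc : CapHarris r b) (D : Finset (X × Y))
    (hD : IsLowerSet (↑D : Set (X × Y))) (ρ β : ℕ) (y : Y) :
    0 ≤ ∑ x, ind D x y * phi2 ρ β (r x) (b x) := by
  have e : ∑ x, ind D x y * phi2 ρ β (r x) (b x)
      = lam2 ρ β * ∑ x, ind D x y * nu r b x
        + mu ρ * ∑ x, ind D x y * (((min (r x) (kap ρ β) : ℕ) : ℤ) - ((min (b x) (kap ρ β) : ℕ) : ℤ)) := by
    rw [Finset.mul_sum, Finset.mul_sum, ← Finset.sum_add_distrib]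
    apply Finset.sum_congr rfl; intro x _
    unfold phi2; rw [nuv_eq]; ring
  rw [e]
  exact add_nonneg (mul_nonneg (lam2_nonneg ρ β) (fibre_fst_nonneg r b hX D hD y))
    (mul_nonneg (mu_nonneg ρ) (fibre_fst_cap r b hXc D hD y (kap ρ β)))

omit [Fintype X] in
/-- the charge of the fibre over `x` is a non-negative combination of (UH) and capped Harris on `Y` -/
theorem fibre_phi_snd (r' b' : Y → ℕ) (hY : DownDom r' b') (hYc : CapHarris r' b') (D : Finset (X × Y))
    (hD : IsLowerSet (↑D : Set (X × Y))) (ρ β : ℕ) (x : X) :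
    0 ≤ ∑ y, ind D x y * phi2 ρ β (r' y) (b' y) := by
  have e : ∑ y, ind D x y * phi2 ρ β (r' y) (b' y)
      = lam2 ρ β * ∑ y, ind D x y * nu r' b' y
        + mu ρ * ∑ y, ind D x y * (((min (r' y) (kap ρ β) : ℕ) : ℤ) - ((min (b' y) (kap ρ β) : ℕ) : ℤ)) := by
    rw [Finset.mul_sum, Finset.mul_sum, ← Finset.sum_add_distrib]
    apply Finset.sum_congr rfl; intro y _
    unfold phi2; rw [nuv_eq]; ring
  rw [e]
  exact add_nonneg (mul_nonneg (lam2_nonneg ρ β) (fibre_snd_nonneg r' b' hY D hD x))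
    (mul_nonneg (mu_nonneg ρ) (fibre_snd_cap r' b' hYc D hD x (kap ρ β)))

/-- **(UH) is closed under series composition** of labelled posets satisfying (UH) and the capped
Harris inequalities (on a pattern cube the latter are Harris–Kleitman): every lower set of the product
with the minimum labels has non-negative `ν`-mass. -/
theorem downDom_ser (r b : X → ℕ) (r' b' : Y → ℕ) (hX : DownDom r b) (hXc : CapHarris r b)
    (hY : DownDom r' b') (hYc : CapHarris r' b') :
    DownDom (fun p : X × Y => min (r p.1) (r' p.2)) (fun p : X × Y => min (b p.1) (b' p.2)) := by
  intro D hD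
  have key : ∀ p ∈ D, phi2 (r' p.2) (b' p.2) (r p.1) (b p.1) + phi2 (r p.1) (b p.1) (r' p.2) (b' p.2)
      ≤ 2 * nu (fun p : X × Y => min (r p.1) (r' p.2)) (fun p : X × Y => min (b p.1) (b' p.2)) p := by
    intro p _
    obtain ⟨x, y⟩ := p
    rw [nu_ser_eq]
    exact pointwise _ _ _ _
  have hsum := Finset.sum_le_sum key
  rw [← Finset.mul_sum, Finset.sum_add_distrib] at hsum
  have h1 : 0 ≤ ∑ p ∈ D, phi2 (r' p.2) (b' p.2) (r p.1) (b p.1) := by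
    rw [sum_D_eq' D (fun x y => phi2 (r' y) (b' y) (r x) (b x)), Finset.sum_comm]
    exact Finset.sum_nonneg (fun y _ => fibre_phi_fst r b hX hXc D hD (r' y) (b' y) y)
  have h2 : 0 ≤ ∑ p ∈ D, phi2 (r p.1) (b p.1) (r' p.2) (b' p.2) := by
    rw [sum_D_eq' D (fun x y => phi2 (r x) (b x) (r' y) (b' y))]
    exact Finset.sum_nonneg (fun x _ => fibre_phi_snd r' b' hY hYc D hD (r x) (b x) x)
  linarith

end fibres

end Summit.Ventures.PercRepro2.UHClosure
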